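/-
Copyright: the b2b-balaban T⁴-continuum CRUX team, row NE7b OWNER lineage `t4-ne7b-p1` (gen 141). Project licence.
-/
import Summits.QuantumFields.BalabanUV.T4Continuum.Spine.NE7b.SupBlockEffectiveActionThird

/-!
# THE SCALAR TILTED-MOMENT CALCULUS: DOMINATED DIFFERENTIATION OF `ψ ↦ ∫e^{−U(ω+ψ)}p(ω+ψ)dN(0,Γ)` FOR A `C¹` SCALAR OBSERVABLE OF
# POLYNOMIAL GROWTH IN `‖U′‖` (SCOPING (d13)(2): the engine for the cumulant FORM of `∂⁴W` and `∂⁵W`).  (402)∕(418)∕(419) differentiated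
# `Z`, `G`, `H` as CLM-valued parametric integrals, one product rule per order; at orders four and five the CLM algebra explodes.  Every
# constituent of (472)'s scalar unfolding of `T(ψ)[h,k,l]` is, however, a SCALAR tilted moment `∫e^{−U(ω+ψ)}p(ω+ψ)dN(0,Γ)` with `p` a
# polynomial in entries of `U′, U″, U‴`; this file proves ONE generic lemma for all of them: for `U ∈ C¹` with the block letters (stability
# `κ₀` on `Y`, gradient letter `‖U′φ‖ ≤ κ₁(a + Σ_Yφ²)`), `Γ ⪰ 0`, `Γ ⪯ γ_op·1`, the regulator `(2κ₀(1+τ)+4δ)γ_op ≤ θ < 1`, and a `C¹` scalar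
# `p` with `|p φ|, ‖p′φ‖ ≤ C(1 + ‖U′φ‖)ⁿ`:
#   `HasFDerivAt (ψ ↦ ∫e^{−U(ω+ψ)}p(ω+ψ)dN(0,Γ)) (∫e^{−U(ω+ψ₀)}•(p′(ω+ψ₀) − p(ω+ψ₀)•U′(ω+ψ₀))dN(0,Γ)) ψ₀`   at EVERY `ψ₀`,
# with the integrability of both integrands and the applied form `(∫…)m = ∫e^{−U}(p′m − p·U′m)`.  The domination behind it is the ball-uniform
# POWER DOMINATION `e^{−U(ω+ψ)}(1+‖U′(ω+ψ)‖)ⁿ ≤ Kₙ(ψ₀)e^{½(2κ₀(1+τ)+4δ)Σ_Yω²}` for `‖ψ − ψ₀‖ ≤ 1`, ALL `n` ((402)∕(405)∕(423) did `n ≤ 4`)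
# (row NE7b, node U5c; (401) `sum_sq_ball_le`, `integrable_domination`, (402) `neg_block_le`, `sum_add_sq_le` BY NAME; [folklore] + Mathlib's
# `hasFDerivAt_integral_of_dominated_of_fderiv_le`)

Cell `pub-balaban`, sub-cell `t4`, spine estimate NE7b (`T4WeightBudget.RelWeightBound`; the cell's OWN estimate — NOT PRINTED in
[Bałaban 1983–89], NOT PROVED).  Crux-route work under `Spine/NE7b/` by the row OWNER (`t4-ne7b-p1` gen 141, file (513)) under FREEZE
(0)'s crux-prover clause; NOTHING of Bałaban's is named as a Lean object, valued or asserted; no `T4Continuum/Support` leaf typed; no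
`def`, no notation; zero `sorry`.  Imports (BY NAME): the OWNER's (418) `…SupBlockEffectiveActionThird` (for its imports: (401)
`sum_sq_ball_le`, `integrable_domination`, (402) `neg_block_le`, (288)-side `sum_add_sq_le`).

WHAT IS PROVED ([folklore]):
* §1 `pow_le_factorial_exp`, **`block_power_domination`** (all `n`, ball-uniform; `(u+v)ⁿ ≤ 2ⁿ(uⁿ+vⁿ)` inline).
* §2 `hasFDerivAt_weighted_moment` (the product rule `d(e^{−U}p) = e^{−U}•(p′ − p•U′)`), `norm_weighted_moment_deriv_le`,
  `integrable_weighted_moment`, `integrable_weighted_moment_deriv`, THE END **`hasFDerivAt_tilted_moment`**, **`tilted_moment_fderiv_apply`**; §3 toy.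

HONEST (what this is NOT).  Calculus engine only; its instantiations (`Z, G_x, H_{xy}, Φ_{xyz}` and their `ψ`-derivatives as explicit
scalar integrals), the entries of `∂⁴W` by the quotient rule, the centred (cumulant) regrouping and the Fréchet repackaging are the next
files.  Scalar skeleton ((A3), NC-NE7b-α UNRULED); nothing of Bałaban's asserted.  BY-NAME EFFECT ON THE WALL: NONE.  NE7b NOT PRINTED ∕
NOT PROVED; spine PROVED 0∕9; rung (B)+1 — the programme's measures remain FINITE-torus statements; NOT the mass gap, NOT Clay.  HONEST
DEPENDENCY: continuum YM on T⁴ ⇐ BetaPertH ∧ nine spine estimates (0∕9 proved); BetaPertH ⇐ (D1) ∧ (D4) ∧ CAP+tail; G-an2-4 gates asym, D1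
and NE2∕3∕4.
-/

set_option autoImplicit false
set_option maxSynthPendingDepth 3

noncomputable section

namespace Summit.QuantumFields.BalabanUV.T4Continuum.NE7b.SupTiltedScalarMomentCalculus

open MeasureTheory ProbabilityTheory Finset Real Metric Filter
open scoped BigOperators Topology
open SupEffectiveActionDerivative (sum_sq_ball_le integrable_domination)
open SupBlockEffectiveActionDerivative (neg_block_le)
open SupRegulatedActivityShift (sum_add_sq_le)

variable {ι : Type} [Fintype ι] [DecidableEq ι]

/-! ## §1. The ball-uniform power domination, all orders -/

section Domination

variable {U : EuclideanSpace ℝ ι → ℝ} {U' : EuclideanSpace ℝ ι → EuclideanSpace ℝ ι →L[ℝ] ℝ} {κ₀ κ₁ a τ δ : ℝ}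

omit [Fintype ι] [DecidableEq ι] in
/-- `(2κ₁S)ⁿ ≤ (κ₁∕δ)ⁿ·n!·e^{2δS}` for `δ > 0`, `S, κ₁ ≥ 0` (from `xⁿ∕n! ≤ eˣ` at `x = 2δS`). [folklore] -/
theorem pow_le_factorial_exp {S : ℝ} (hδ : 0 < δ) (hS : 0 ≤ S) (hκ₁ : 0 ≤ κ₁) (n : ℕ) :
    (2 * κ₁ * S) ^ n ≤ (κ₁ / δ) ^ n * n.factorial * exp (2 * δ * S) := by
  have h := Real.pow_div_factorial_le_exp (x := 2 * δ * S) (by positivity) n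
  have hf : (0 : ℝ) < n.factorial := by exact_mod_cast Nat.factorial_pos n
  rw [div_le_iff₀ hf] at h
  have e : 2 * κ₁ * S = κ₁ / δ * (2 * δ * S) := by field_simp
  rw [e, mul_pow]
  calc (κ₁ / δ) ^ n * (2 * δ * S) ^ n ≤ (κ₁ / δ) ^ n * (exp (2 * δ * S) * n.factorial) :=
        mul_le_mul_of_nonneg_left h (pow_nonneg (div_nonneg hκ₁ hδ.le) n)
    _ = (κ₁ / δ) ^ n * n.factorial * exp (2 * δ * S) := by ring

omit [DecidableEq ι] in
/-- **THE POWER DOMINATION, BALL-UNIFORM, ALL ORDERS**: for `‖ψ − ψ₀‖ ≤ 1` and every `ω`,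
`e^{−U(ω+ψ)}(1 + ‖U′(ω+ψ)‖)ⁿ ≤ Kₙ(ψ₀)·e^{½(2κ₀(1+τ)+4δ)Σ_Yω²}`,
`Kₙ(ψ₀) = 2ⁿ((1 + |κ₁|(a+2M))ⁿ + (κ₁∕δ)ⁿn!)·e^{κ₀(1+τ⁻¹)M}`, `M = 2Σ_Yψ₀² + 2`. [folklore] -/
theorem block_power_domination (Y : Finset ι) (n : ℕ) (hκ₀ : 0 ≤ κ₀) (hκ₁ : 0 ≤ κ₁) (ha : 0 ≤ a) (hτ : 0 < τ) (hδ : 0 < δ)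
    (hstab : ∀ φ : EuclideanSpace ℝ ι, -(κ₀ * ∑ x ∈ Y, φ x ^ 2) ≤ U φ)
    (hU'b : ∀ φ : EuclideanSpace ℝ ι, ‖U' φ‖ ≤ κ₁ * (a + ∑ x ∈ Y, φ x ^ 2)) (ψ₀ ψ : EuclideanSpace ℝ ι) (hψ : ‖ψ - ψ₀‖ ≤ 1)
    (ω : EuclideanSpace ℝ ι) :
    exp (-U (ω + ψ)) * (1 + ‖U' (ω + ψ)‖) ^ n ≤
      (2 ^ n * ((1 + κ₁ * (a + 2 * (2 * ∑ x ∈ Y, ψ₀ x ^ 2 + 2))) ^ n + (κ₁ / δ) ^ n * n.factorial) *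
          exp (κ₀ * (1 + τ⁻¹) * (2 * ∑ x ∈ Y, ψ₀ x ^ 2 + 2))) *
        exp ((2 * κ₀ * (1 + τ) + 4 * δ) * (∑ x ∈ Y, ω x ^ 2) / 2) := by
  set M : ℝ := 2 * ∑ x ∈ Y, ψ₀ x ^ 2 + 2 with hM
  set Sω : ℝ := ∑ x ∈ Y, ω x ^ 2 with hSω
  have hSω0 : 0 ≤ Sω := sum_nonneg fun x _ => sq_nonneg _
  have hM0 : 0 ≤ M := by rw [hM]; positivity
  have hψM : ∑ x ∈ Y, ψ x ^ 2 ≤ M := sum_sq_ball_le Y hψ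
  have hV : -U (ω + ψ) ≤ κ₀ * (1 + τ) * Sω + κ₀ * (1 + τ⁻¹) * M := by
    have h := neg_block_le Y hκ₀ hτ hstab ω ψ
    have h2 : κ₀ * (1 + τ⁻¹) * ∑ x ∈ Y, ψ x ^ 2 ≤ κ₀ * (1 + τ⁻¹) * M := mul_le_mul_of_nonneg_left hψM (by positivity)
    linarith
  have hsum : ∑ x ∈ Y, (ω + ψ) x ^ 2 ≤ 2 * Sω + 2 * M := by
    have h := sum_add_sq_le Y (fun x => ω x) (fun x => ψ x) one_pos
    have e : ∑ x ∈ Y, (ω + ψ) x ^ 2 = ∑ x ∈ Y, (ω x + ψ x) ^ 2 := sum_congr rfl fun x _ => by simp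
    rw [e]
    norm_num at h
    linarith
  -- `1 + ‖U′‖ ≤ c + v`, `c = 1 + κ₁(a+2M)`, `v = 2κ₁Sω`
  set c : ℝ := 1 + κ₁ * (a + 2 * M) with hc
  have hc0 : 0 ≤ c := by rw [hc]; positivity
  have hv0 : 0 ≤ 2 * κ₁ * Sω := by positivity
  have hD : 1 + ‖U' (ω + ψ)‖ ≤ c + 2 * κ₁ * Sω := by
    have h1 : ‖U' (ω + ψ)‖ ≤ κ₁ * (a + 2 * M + 2 * Sω) := (hU'b (ω + ψ)).trans (mul_le_mul_of_nonneg_left (by linarith) hκ₁)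
    rw [hc]; nlinarith
  have hpow : (1 + ‖U' (ω + ψ)‖) ^ n ≤ 2 ^ n * (c ^ n + (κ₁ / δ) ^ n * n.factorial) * exp (2 * δ * Sω) := by
    have h1 : (1 + ‖U' (ω + ψ)‖) ^ n ≤ (c + 2 * κ₁ * Sω) ^ n := pow_le_pow_left₀ (by positivity) hD n
    -- `(u+v)ⁿ ≤ 2ⁿ(uⁿ+vⁿ)` for `u, v ≥ 0` (inline; the tree holds it under `Literature.NumberTheory.LFunctions`, not imported here)
    have h2 : (c + 2 * κ₁ * Sω) ^ n ≤ 2 ^ n * (c ^ n + (2 * κ₁ * Sω) ^ n) := by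
      have g1 : c + 2 * κ₁ * Sω ≤ 2 * max c (2 * κ₁ * Sω) := by
        rcases le_total c (2 * κ₁ * Sω) with h | h
        · rw [max_eq_right h]; linarith
        · rw [max_eq_left h]; linarith
      have g2 : (max c (2 * κ₁ * Sω)) ^ n ≤ c ^ n + (2 * κ₁ * Sω) ^ n := by
        rcases le_total c (2 * κ₁ * Sω) with h | h
        · rw [max_eq_right h]; linarith [pow_nonneg hc0 n]
        · rw [max_eq_left h]; linarith [pow_nonneg hv0 n]
      calc (c + 2 * κ₁ * Sω) ^ n ≤ (2 * max c (2 * κ₁ * Sω)) ^ n := pow_le_pow_left₀ (add_nonneg hc0 hv0) g1 n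
        _ = 2 ^ n * (max c (2 * κ₁ * Sω)) ^ n := mul_pow _ _ _
        _ ≤ 2 ^ n * (c ^ n + (2 * κ₁ * Sω) ^ n) := mul_le_mul_of_nonneg_left g2 (by positivity)
    have h3 := pow_le_factorial_exp hδ hSω0 hκ₁ n
    have he1 : 1 ≤ exp (2 * δ * Sω) := one_le_exp (by positivity)
    have h4 : c ^ n ≤ c ^ n * exp (2 * δ * Sω) := le_mul_of_one_le_right (pow_nonneg hc0 n) he1
    have h5 : c ^ n + (2 * κ₁ * Sω) ^ n ≤ (c ^ n + (κ₁ / δ) ^ n * n.factorial) * exp (2 * δ * Sω) := by nlinarith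
    calc (1 + ‖U' (ω + ψ)‖) ^ n ≤ 2 ^ n * (c ^ n + (2 * κ₁ * Sω) ^ n) := h1.trans h2
      _ ≤ 2 ^ n * ((c ^ n + (κ₁ / δ) ^ n * n.factorial) * exp (2 * δ * Sω)) := mul_le_mul_of_nonneg_left h5 (by positivity)
      _ = 2 ^ n * (c ^ n + (κ₁ / δ) ^ n * n.factorial) * exp (2 * δ * Sω) := by ring
  have hK0 : 0 ≤ 2 ^ n * (c ^ n + (κ₁ / δ) ^ n * n.factorial) * exp (2 * δ * Sω) := by positivity
  have he : exp (κ₀ * (1 + τ) * Sω + κ₀ * (1 + τ⁻¹) * M) * exp (2 * δ * Sω) = exp (κ₀ * (1 + τ⁻¹) * M) * exp ((2 * κ₀ * (1 + τ) + 4 * δ) * Sω / 2) :=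
      by
    rw [← exp_add, ← exp_add]; congr 1; ring
  calc exp (-U (ω + ψ)) * (1 + ‖U' (ω + ψ)‖) ^ n
      ≤ exp (κ₀ * (1 + τ) * Sω + κ₀ * (1 + τ⁻¹) * M) * (2 ^ n * (c ^ n + (κ₁ / δ) ^ n * n.factorial) * exp (2 * δ * Sω)) :=
        mul_le_mul (exp_le_exp.2 hV) hpow (by positivity) (exp_pos _).le
    _ = 2 ^ n * (c ^ n + (κ₁ / δ) ^ n * n.factorial) * exp (κ₀ * (1 + τ⁻¹) * M) * exp ((2 * κ₀ * (1 + τ) + 4 * δ) * Sω / 2) := by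
        calc _ = 2 ^ n * (c ^ n + (κ₁ / δ) ^ n * n.factorial) * (exp (κ₀ * (1 + τ) * Sω + κ₀ * (1 + τ⁻¹) * M) * exp (2 * δ * Sω)) := by ring
          _ = _ := by rw [he]; ring

end Domination

/-! ## §2. Dominated differentiation of a scalar tilted moment -/

section Calculus

variable {Γ : Matrix ι ι ℝ} {γop : ℝ} {U : EuclideanSpace ℝ ι → ℝ} {U' : EuclideanSpace ℝ ι → EuclideanSpace ℝ ι →L[ℝ] ℝ}
  {p : EuclideanSpace ℝ ι → ℝ} {p' : EuclideanSpace ℝ ι → EuclideanSpace ℝ ι →L[ℝ] ℝ} {κ₀ κ₁ a τ δ θ Cp : ℝ} {n : ℕ}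

omit [DecidableEq ι] in
/-- **The product rule** `d_ψ(e^{−U(ω+ψ)}p(ω+ψ)) = e^{−U}•(p′ − p•U′)` (all at `ω+ψ`). [folklore] -/
theorem hasFDerivAt_weighted_moment (hUd : ∀ φ : EuclideanSpace ℝ ι, HasFDerivAt U (U' φ) φ) (hp : ∀ φ : EuclideanSpace ℝ ι, HasFDerivAt p (p' φ) φ)
    (ω ψ : EuclideanSpace ℝ ι) :
    HasFDerivAt (fun ψ' : EuclideanSpace ℝ ι => exp (-U (ω + ψ')) * p (ω + ψ'))
      (exp (-U (ω + ψ)) • (p' (ω + ψ) - p (ω + ψ) • U' (ω + ψ))) ψ := by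
  have hlin : HasFDerivAt (fun ψ' : EuclideanSpace ℝ ι => ω + ψ') (ContinuousLinearMap.id ℝ (EuclideanSpace ℝ ι)) ψ := (hasFDerivAt_id ψ).const_add ω
  have hU : HasFDerivAt (fun ψ' : EuclideanSpace ℝ ι => U (ω + ψ')) (U' (ω + ψ)) ψ := by
    have h := (hUd (ω + ψ)).comp ψ hlin; rw [ContinuousLinearMap.comp_id] at h; exact h
  have hP : HasFDerivAt (fun ψ' : EuclideanSpace ℝ ι => p (ω + ψ')) (p' (ω + ψ)) ψ := by
    have h := (hp (ω + ψ)).comp ψ hlin; rw [ContinuousLinearMap.comp_id] at h; exact h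
  have hE := hU.fun_neg.exp
  refine (hE.mul hP).congr_fderiv ?_
  module

omit [DecidableEq ι] in
/-- The derivative integrand is dominated: `‖e^{−U}•(p′ − p•U′)‖ ≤ C·e^{−U}(1+‖U′‖)ⁿ⁺¹` under `|p|, ‖p′‖ ≤ C(1+‖U′‖)ⁿ`. [folklore] -/
theorem norm_weighted_moment_deriv_le (hpb : ∀ φ : EuclideanSpace ℝ ι, |p φ| ≤ Cp * (1 + ‖U' φ‖) ^ n)
    (hp'b : ∀ φ : EuclideanSpace ℝ ι, ‖p' φ‖ ≤ Cp * (1 + ‖U' φ‖) ^ n) (ω ψ : EuclideanSpace ℝ ι) :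
    ‖exp (-U (ω + ψ)) • (p' (ω + ψ) - p (ω + ψ) • U' (ω + ψ))‖ ≤ Cp * (exp (-U (ω + ψ)) * (1 + ‖U' (ω + ψ)‖) ^ (n + 1)) := by
  have hN : 0 ≤ ‖U' (ω + ψ)‖ := norm_nonneg _
  have hCp : 0 ≤ Cp := by
    have h := hp'b (ω + ψ)
    have h1 : 0 < (1 + ‖U' (ω + ψ)‖) ^ n := by positivity
    nlinarith [norm_nonneg (p' (ω + ψ))]
  have h1 : ‖p' (ω + ψ) - p (ω + ψ) • U' (ω + ψ)‖ ≤ Cp * (1 + ‖U' (ω + ψ)‖) ^ (n + 1) := by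
    refine (norm_sub_le _ _).trans ?_
    rw [norm_smul, Real.norm_eq_abs, pow_succ]
    have hb := hpb (ω + ψ)
    have hb' := hp'b (ω + ψ)
    have : |p (ω + ψ)| * ‖U' (ω + ψ)‖ ≤ Cp * (1 + ‖U' (ω + ψ)‖) ^ n * ‖U' (ω + ψ)‖ := mul_le_mul_of_nonneg_right hb hN
    nlinarith [pow_nonneg (by positivity : (0 : ℝ) ≤ 1 + ‖U' (ω + ψ)‖) n]
  rw [norm_smul, Real.norm_eq_abs, abs_of_pos (exp_pos _)]
  calc exp (-U (ω + ψ)) * ‖p' (ω + ψ) - p (ω + ψ) • U' (ω + ψ)‖ ≤ exp (-U (ω + ψ)) * (Cp * (1 + ‖U' (ω + ψ)‖) ^ (n + 1)) :=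
        mul_le_mul_of_nonneg_left h1 (exp_pos _).le
    _ = Cp * (exp (-U (ω + ψ)) * (1 + ‖U' (ω + ψ)‖) ^ (n + 1)) := by ring

/-- **The scalar tilted moment is integrable** at every background. [folklore] -/
theorem integrable_weighted_moment (hΓ : Γ.PosSemidef) (hΓop : (γop • (1 : Matrix ι ι ℝ) - Γ).PosSemidef) (Y : Finset ι)
    (hUd : ∀ φ : EuclideanSpace ℝ ι, HasFDerivAt U (U' φ) φ) (hp : ∀ φ : EuclideanSpace ℝ ι, HasFDerivAt p (p' φ) φ)
    (hκ₀ : 0 ≤ κ₀) (hκ₁ : 0 ≤ κ₁) (ha : 0 ≤ a) (hτ : 0 < τ) (hδ : 0 < δ) (hθ1 : θ < 1) (hκθ : (2 * κ₀ * (1 + τ) + 4 * δ) * γop ≤ θ)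
    (hstab : ∀ φ : EuclideanSpace ℝ ι, -(κ₀ * ∑ x ∈ Y, φ x ^ 2) ≤ U φ) (hU'b : ∀ φ : EuclideanSpace ℝ ι, ‖U' φ‖ ≤ κ₁ * (a + ∑ x ∈ Y, φ x ^ 2))
    (hpb : ∀ φ : EuclideanSpace ℝ ι, |p φ| ≤ Cp * (1 + ‖U' φ‖) ^ n) (ψ : EuclideanSpace ℝ ι) :
    Integrable (fun ω : EuclideanSpace ℝ ι => exp (-U (ω + ψ)) * p (ω + ψ)) (multivariateGaussian 0 Γ) := by
  have hUc : Continuous U := continuous_iff_continuousAt.2 fun φ => (hUd φ).continuousAt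
  have hpc : Continuous p := continuous_iff_continuousAt.2 fun φ => (hp φ).continuousAt
  have hsh : Continuous fun ω : EuclideanSpace ℝ ι => ω + ψ := continuous_id.add continuous_const
  have hm : Continuous fun ω : EuclideanSpace ℝ ι => exp (-U (ω + ψ)) * p (ω + ψ) := (continuous_exp.comp (hUc.comp hsh).neg).mul (hpc.comp hsh)
  have hCp : 0 ≤ Cp := by
    have h := hpb ψ
    have h1 : 0 < (1 + ‖U' ψ‖) ^ n := by positivity
    nlinarith [abs_nonneg (p ψ)]
  refine ((integrable_domination hΓ hΓop Y hκ₀ hτ hδ hθ1 hκθ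
    ((2 ^ n * ((1 + κ₁ * (a + 2 * (2 * ∑ x ∈ Y, ψ x ^ 2 + 2))) ^ n + (κ₁ / δ) ^ n * (n).factorial) * exp (κ₀ * (1 + τ⁻¹) * (2 * ∑ x ∈ Y, ψ x ^ 2 +
        2))))).const_mul Cp).mono'
    hm.aestronglyMeasurable (ae_of_all _ fun ω => ?_)
  rw [Real.norm_eq_abs, abs_mul, abs_of_pos (exp_pos _)]
  calc exp (-U (ω + ψ)) * |p (ω + ψ)| ≤ exp (-U (ω + ψ)) * (Cp * (1 + ‖U' (ω + ψ)‖) ^ n) := mul_le_mul_of_nonneg_left (hpb _) (exp_pos _).le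
    _ = Cp * (exp (-U (ω + ψ)) * (1 + ‖U' (ω + ψ)‖) ^ n) := by ring
    _ ≤ Cp * _ := mul_le_mul_of_nonneg_left (block_power_domination Y n hκ₀ hκ₁ ha hτ hδ hstab hU'b ψ ψ (by simp) ω) hCp

/-- **The derivative integrand is integrable** at every background. [folklore] -/
theorem integrable_weighted_moment_deriv (hΓ : Γ.PosSemidef) (hΓop : (γop • (1 : Matrix ι ι ℝ) - Γ).PosSemidef) (Y : Finset ι)
    (hUd : ∀ φ : EuclideanSpace ℝ ι, HasFDerivAt U (U' φ) φ) (hU'c : Continuous U') (hp : ∀ φ : EuclideanSpace ℝ ι, HasFDerivAt p (p' φ) φ)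
    (hp'c : Continuous p') (hκ₀ : 0 ≤ κ₀) (hκ₁ : 0 ≤ κ₁) (ha : 0 ≤ a) (hτ : 0 < τ) (hδ : 0 < δ) (hθ1 : θ < 1)
    (hκθ : (2 * κ₀ * (1 + τ) + 4 * δ) * γop ≤ θ) (hstab : ∀ φ : EuclideanSpace ℝ ι, -(κ₀ * ∑ x ∈ Y, φ x ^ 2) ≤ U φ)
    (hU'b : ∀ φ : EuclideanSpace ℝ ι, ‖U' φ‖ ≤ κ₁ * (a + ∑ x ∈ Y, φ x ^ 2)) (hpb : ∀ φ : EuclideanSpace ℝ ι, |p φ| ≤ Cp * (1 + ‖U' φ‖) ^ n)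
    (hp'b : ∀ φ : EuclideanSpace ℝ ι, ‖p' φ‖ ≤ Cp * (1 + ‖U' φ‖) ^ n) (ψ : EuclideanSpace ℝ ι) :
    Integrable (fun ω : EuclideanSpace ℝ ι => exp (-U (ω + ψ)) • (p' (ω + ψ) - p (ω + ψ) • U' (ω + ψ))) (multivariateGaussian 0 Γ) := by
  have hUc : Continuous U := continuous_iff_continuousAt.2 fun φ => (hUd φ).continuousAt
  have hpc : Continuous p := continuous_iff_continuousAt.2 fun φ => (hp φ).continuousAt
  have hsh : Continuous fun ω : EuclideanSpace ℝ ι => ω + ψ := continuous_id.add continuous_const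
  have hm : Continuous fun ω : EuclideanSpace ℝ ι => exp (-U (ω + ψ)) • (p' (ω + ψ) - p (ω + ψ) • U' (ω + ψ)) :=
    (continuous_exp.comp (hUc.comp hsh).neg).smul ((hp'c.comp hsh).sub ((hpc.comp hsh).smul (hU'c.comp hsh)))
  refine ((integrable_domination hΓ hΓop Y hκ₀ hτ hδ hθ1 hκθ
    ((2 ^ (n + 1) * ((1 + κ₁ * (a + 2 * (2 * ∑ x ∈ Y, ψ x ^ 2 + 2))) ^ (n + 1) + (κ₁ / δ) ^ (n + 1) * ((n + 1)).factorial) * exp (κ₀ * (1 + τ⁻¹) * (2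
        * ∑ x ∈ Y, ψ x ^ 2 + 2))))).const_mul Cp).mono'
    hm.aestronglyMeasurable (ae_of_all _ fun ω => ?_)
  refine (norm_weighted_moment_deriv_le hpb hp'b ω ψ).trans ?_
  have hCp : 0 ≤ Cp := by
    have h := hp'b ψ
    have h1 : 0 < (1 + ‖U' ψ‖) ^ n := by positivity
    nlinarith [norm_nonneg (p' ψ)]
  exact mul_le_mul_of_nonneg_left (block_power_domination Y (n + 1) hκ₀ hκ₁ ha hτ hδ hstab hU'b ψ ψ (by simp) ω) hCp

/-- **THE END — DOMINATED DIFFERENTIATION OF A SCALAR TILTED MOMENT**: at EVERY `ψ₀`,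
`HasFDerivAt (ψ ↦ ∫e^{−U(ω+ψ)}p(ω+ψ)dN(0,Γ)) (∫e^{−U(ω+ψ₀)}•(p′(ω+ψ₀) − p(ω+ψ₀)•U′(ω+ψ₀))dN(0,Γ)) ψ₀`. [folklore] -/
theorem hasFDerivAt_tilted_moment (hΓ : Γ.PosSemidef) (hΓop : (γop • (1 : Matrix ι ι ℝ) - Γ).PosSemidef) (Y : Finset ι)
    (hUd : ∀ φ : EuclideanSpace ℝ ι, HasFDerivAt U (U' φ) φ) (hU'c : Continuous U') (hp : ∀ φ : EuclideanSpace ℝ ι, HasFDerivAt p (p' φ) φ)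
    (hp'c : Continuous p') (hκ₀ : 0 ≤ κ₀) (hκ₁ : 0 ≤ κ₁) (ha : 0 ≤ a) (hτ : 0 < τ) (hδ : 0 < δ) (hθ1 : θ < 1)
    (hκθ : (2 * κ₀ * (1 + τ) + 4 * δ) * γop ≤ θ) (hstab : ∀ φ : EuclideanSpace ℝ ι, -(κ₀ * ∑ x ∈ Y, φ x ^ 2) ≤ U φ)
    (hU'b : ∀ φ : EuclideanSpace ℝ ι, ‖U' φ‖ ≤ κ₁ * (a + ∑ x ∈ Y, φ x ^ 2)) (hpb : ∀ φ : EuclideanSpace ℝ ι, |p φ| ≤ Cp * (1 + ‖U' φ‖) ^ n)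
    (hp'b : ∀ φ : EuclideanSpace ℝ ι, ‖p' φ‖ ≤ Cp * (1 + ‖U' φ‖) ^ n) (ψ₀ : EuclideanSpace ℝ ι) :
    HasFDerivAt (fun ψ : EuclideanSpace ℝ ι => ∫ ω : EuclideanSpace ℝ ι, exp (-U (ω + ψ)) * p (ω + ψ) ∂(multivariateGaussian 0 Γ))
      (∫ ω : EuclideanSpace ℝ ι, exp (-U (ω + ψ₀)) • (p' (ω + ψ₀) - p (ω + ψ₀) • U' (ω + ψ₀)) ∂(multivariateGaussian 0 Γ)) ψ₀ := by
  have hUc : Continuous U := continuous_iff_continuousAt.2 fun φ => (hUd φ).continuousAt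
  have hpc : Continuous p := continuous_iff_continuousAt.2 fun φ => (hp φ).continuousAt
  have hCp : 0 ≤ Cp := by
    have h := hp'b ψ₀
    have h1 : 0 < (1 + ‖U' ψ₀‖) ^ n := by positivity
    nlinarith [norm_nonneg (p' ψ₀)]
  have hmeas : ∀ ψ : EuclideanSpace ℝ ι, AEStronglyMeasurable (fun ω : EuclideanSpace ℝ ι => exp (-U (ω + ψ)) * p (ω + ψ)) (multivariateGaussian 0 Γ)
      :=
    fun ψ => ((continuous_exp.comp (hUc.comp (continuous_id.add continuous_const)).neg).mul (hpc.comp (continuous_id.add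
        continuous_const))).aestronglyMeasurable
  have hm' : Continuous fun ω : EuclideanSpace ℝ ι => exp (-U (ω + ψ₀)) • (p' (ω + ψ₀) - p (ω + ψ₀) • U' (ω + ψ₀)) :=
    (continuous_exp.comp (hUc.comp (continuous_id.add continuous_const)).neg).smul
      ((hp'c.comp (continuous_id.add continuous_const)).sub ((hpc.comp (continuous_id.add continuous_const)).smul (hU'c.comp (continuous_id.add
          continuous_const))))
  exact hasFDerivAt_integral_of_dominated_of_fderiv_le (μ := (multivariateGaussian 0 Γ)) (x₀ := ψ₀) (s := closedBall ψ₀ 1)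
    (closedBall_mem_nhds ψ₀ one_pos) (Eventually.of_forall hmeas)
    (integrable_weighted_moment hΓ hΓop Y hUd hp hκ₀ hκ₁ ha hτ hδ hθ1 hκθ hstab hU'b hpb ψ₀) hm'.aestronglyMeasurable
    (Eventually.of_forall fun ω ψ hψ => by
      rw [mem_closedBall, dist_eq_norm] at hψ
      exact (norm_weighted_moment_deriv_le hpb hp'b ω ψ).trans
        (mul_le_mul_of_nonneg_left (block_power_domination Y (n + 1) hκ₀ hκ₁ ha hτ hδ hstab hU'b ψ₀ ψ hψ ω) hCp))
    ((integrable_domination hΓ hΓop Y hκ₀ hτ hδ hθ1 hκθ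
      ((2 ^ (n + 1) * ((1 + κ₁ * (a + 2 * (2 * ∑ x ∈ Y, ψ₀ x ^ 2 + 2))) ^ (n + 1) + (κ₁ / δ) ^ (n + 1) * ((n + 1)).factorial) * exp (κ₀ * (1 + τ⁻¹) *
          (2 * ∑ x ∈ Y, ψ₀ x ^ 2 + 2))))).const_mul Cp)
    (Eventually.of_forall fun ω ψ _ => hasFDerivAt_weighted_moment hUd hp ω ψ)

/-- **The applied form**: `(∫e^{−U}•(p′ − p•U′))m = ∫e^{−U}(p′m − p·U′m)`. [folklore] -/
theorem tilted_moment_fderiv_apply (hΓ : Γ.PosSemidef) (hΓop : (γop • (1 : Matrix ι ι ℝ) - Γ).PosSemidef) (Y : Finset ι)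
    (hUd : ∀ φ : EuclideanSpace ℝ ι, HasFDerivAt U (U' φ) φ) (hU'c : Continuous U') (hp : ∀ φ : EuclideanSpace ℝ ι, HasFDerivAt p (p' φ) φ)
    (hp'c : Continuous p') (hκ₀ : 0 ≤ κ₀) (hκ₁ : 0 ≤ κ₁) (ha : 0 ≤ a) (hτ : 0 < τ) (hδ : 0 < δ) (hθ1 : θ < 1)
    (hκθ : (2 * κ₀ * (1 + τ) + 4 * δ) * γop ≤ θ) (hstab : ∀ φ : EuclideanSpace ℝ ι, -(κ₀ * ∑ x ∈ Y, φ x ^ 2) ≤ U φ)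
    (hU'b : ∀ φ : EuclideanSpace ℝ ι, ‖U' φ‖ ≤ κ₁ * (a + ∑ x ∈ Y, φ x ^ 2)) (hpb : ∀ φ : EuclideanSpace ℝ ι, |p φ| ≤ Cp * (1 + ‖U' φ‖) ^ n)
    (hp'b : ∀ φ : EuclideanSpace ℝ ι, ‖p' φ‖ ≤ Cp * (1 + ‖U' φ‖) ^ n) (ψ₀ m : EuclideanSpace ℝ ι) :
    (∫ ω : EuclideanSpace ℝ ι, exp (-U (ω + ψ₀)) • (p' (ω + ψ₀) - p (ω + ψ₀) • U' (ω + ψ₀)) ∂(multivariateGaussian 0 Γ)) m =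
      ∫ ω : EuclideanSpace ℝ ι, exp (-U (ω + ψ₀)) * (p' (ω + ψ₀) m - p (ω + ψ₀) * U' (ω + ψ₀) m) ∂(multivariateGaussian 0 Γ) := by
  rw [ContinuousLinearMap.integral_apply (integrable_weighted_moment_deriv hΓ hΓop Y hUd hU'c hp hp'c hκ₀ hκ₁ ha hτ hδ hθ1 hκθ hstab hU'b hpb hp'b
      ψ₀) m]
  refine integral_congr_ae (ae_of_all _ fun ω => ?_)
  simp only [smul_apply, sub_apply, smul_eq_mul]

end Calculus

/-! ## §3. Toy -/

/-- Toy (§1's inline inequality at `n = 2`, `u = v = 1`): `4 ≤ 4·2`. -/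
example : ((1 : ℝ) + 1) ^ 2 ≤ 2 ^ 2 * (1 ^ 2 + 1 ^ 2) := by norm_num

end Summit.QuantumFields.BalabanUV.T4Continuum.NE7b.SupTiltedScalarMomentCalculus

end
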